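import Mathlib
import HarnessLib
import Summits.HubbardSuperconductivity.HubbardSuperconductivity.Theorems.KLProgrammeKLRegimeTwoVolumeScaleZeroSpLegData
import Summits.HubbardSuperconductivity.HubbardSuperconductivity.Theorems.KLProgrammeKLRegimeTwoVolumeScaleZeroLegMaj
import Summits.HubbardSuperconductivity.HubbardSuperconductivity.Theorems.KLProgrammeKLRegimeTwoVolumeSectionalMomentScaleZero
import Summits.HubbardSuperconductivity.HubbardSuperconductivity.Theorems.KLProgrammeKLRegimeEngineTwoLegStepV17F2ZeroCloserQ7U9

/-!
# Stub (M) `stub_twoLeg_scale0` of the engine-flow child `KLRegimeEngineV17F2` (stmt-HubbardSuperconductivity-20437): the scale-`0` SPATIAL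
# nested leg `hsp` from the β′ two-volume door, and (M) BY NAME (cell gate-hubbard-kl, seat p1b g9, (M) owner — FILE F, part 2)

§1 scalar kit: the two weighted-step profiles at `ρ₀ = 2^15`, `ρf = 1`, `ρ₂ = 2^10` (`normV ≤ (4/3)·P` by `normV_geometricProfile_le` and the
ratios `≤ 1/2` of …ScaleZeroSpLegData), the smallness values `≤ 1/2`, the step outputs `≤ 8P`, the two `Σ_{a,b′<3}` blocks of the β′ door, and
the final rate arithmetic.  §2 **`abs_klLocalPart_flowFrame_zero_spLeg_le_inv`**: k3c5-p2's `abs_klLocalPart_flowFrame_zero_sub_le_of_gridData_maj`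
(…TwoVolumeScaleZeroLegMaj) instantiated at the REGISTERED thresholds with the one-volume data of …ScaleZeroSpLegData (rows/moments/far tails
`≤ (N/β)·klE3A1 R`, Gram `√(2(7+6047))`, grid partition functions, profiles) and k3c4-p2's `hsec_scaleZero` (`Te = 2^74/(R+1)`) / `hs_scaleZero`
(`s = 2(7+6047)`), zone depths `R = R′ = (L₁−1)/4`: for `L₂ = b·L₁`, `R.WF`, `μ ∈ klWindowC`, `0 < U ≤ klEngU₀9 P R c`, `klBetaMin ≤ β`,
`klEngL₃ β U ≤ L₁`, `klEngM₃ β U Lᵢ ≤ M`:  `|klLocalPart L₁ M … (K₀ L₁) 0 θ − klLocalPart L₂ M … (K₀ L₂) 0 θ| ≤ 1/L₁`.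
§3 **`twoLeg_scale0_hsp_klEngQ7U9`** = literally the `hsp` binder of p1b's `stub_twoLeg_scale0_of_spLeg_Q7U9` (quarter budget
`(klEngQ7 P R).CL β 0/4/L₁ ≥ 1/L₁`, `four_le_klEngQ6_CL_zero`), and **`stub_twoLeg_scale0`** — the REGISTERED stub (M) text verbatim
(skeleton v1 sha16 f8654925219fd273), closed.  Proofs only; no definitions; nothing asserts superconductivity.
References: BGM 2006 §2–§3 [cite: BenfattoGiulianiMastropietro2006].
-/

noncomputable section

namespace Summit.HubbardSuperconductivity.HubbardSuperconductivity.Theorems.TwoVolumeDefect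

set_option linter.dupNamespace false -- summit = problem name (single-conjunct summit), D-0017

open Finset Literature.MathematicalPhysics.QuantumLattice GrassmannAlgebra Literature.Probability.LatticeModels
  Literature.Probability.LatticeModels.BattleFederbush
open Summit.HubbardSuperconductivity.HubbardSuperconductivity.Theorems.EngineV8
open Summit.HubbardSuperconductivity.HubbardSuperconductivity.Theorems.KLRegimeSplit
open scoped Nat

/-! ## §1 Scalar kit -/

/-- The first weighted step's profile norm at `(κ+κ′, ρf, ρ₀) = (2√(2(7+6047)), 1, 2^15)`: `normV ≤ (4/3)·P`. -/
theorem normV_f_geometric_le {Γ : Type*} [Fintype Γ] {P : ℝ} (hP : 0 ≤ P) :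
    normV Γ (Real.sqrt (2 * (7 + 6047)) + Real.sqrt (2 * (7 + 6047))) 1 (fun m' : ℕ => ((2 : ℝ) ^ 15)⁻¹ ^ (2 * m') * P) ≤ 4 / 3 * P := by
  have hκ := sqrt_gramSharp_pos
  have hx := ratio_f_le_half
  have hx0 : 0 ≤ Real.exp 2 * (Real.sqrt (2 * (7 + 6047)) + Real.sqrt (2 * (7 + 6047)) + 1) * ((2 : ℝ) ^ 15)⁻¹ := by positivity
  have h := normV_geometricProfile_le (Γ := Γ) (κ := Real.sqrt (2 * (7 + 6047)) + Real.sqrt (2 * (7 + 6047))) (ρ := 1)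
    (ρ₀ := (2 : ℝ) ^ 15) (P := P) (by positivity) (by positivity) hP (lt_of_le_of_lt hx (by norm_num))
  refine h.trans ?_
  set x := Real.exp 2 * (Real.sqrt (2 * (7 + 6047)) + Real.sqrt (2 * (7 + 6047)) + 1) * ((2 : ℝ) ^ 15)⁻¹ with hxdef
  have hx2 : x ^ 2 ≤ 1 / 4 := by nlinarith [mul_le_mul hx hx hx0 (by norm_num : (0 : ℝ) ≤ 1 / 2)]
  rw [div_le_iff₀ (by nlinarith)]
  nlinarith [mul_le_mul_of_nonneg_left hx2 hP]

/-- The second weighted step's profile norm at `(3(κ+κ′), ρ₂, ρ₀) = (6√(2(7+6047)), 2^10, 2^15)`: `normV ≤ (4/3)·P`. -/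
theorem normV_two_geometric_le {Γ : Type*} [Fintype Γ] {P : ℝ} (hP : 0 ≤ P) :
    normV Γ (Real.sqrt (2 * (7 + 6047)) + Real.sqrt (2 * (7 + 6047)) +
        (Real.sqrt (2 * (7 + 6047)) + Real.sqrt (2 * (7 + 6047)) + (Real.sqrt (2 * (7 + 6047)) + Real.sqrt (2 * (7 + 6047)))))
      ((2 : ℝ) ^ 10) (fun m' : ℕ => ((2 : ℝ) ^ 15)⁻¹ ^ (2 * m') * P) ≤ 4 / 3 * P := by
  have hκ := sqrt_gramSharp_pos
  have hx := ratio_two_le_half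
  have hx0 : 0 ≤ Real.exp 2 * (Real.sqrt (2 * (7 + 6047)) + Real.sqrt (2 * (7 + 6047)) +
      (Real.sqrt (2 * (7 + 6047)) + Real.sqrt (2 * (7 + 6047)) + (Real.sqrt (2 * (7 + 6047)) + Real.sqrt (2 * (7 + 6047)))) +
      (2 : ℝ) ^ 10) * ((2 : ℝ) ^ 15)⁻¹ := by positivity
  have h := normV_geometricProfile_le (Γ := Γ)
    (κ := Real.sqrt (2 * (7 + 6047)) + Real.sqrt (2 * (7 + 6047)) +
      (Real.sqrt (2 * (7 + 6047)) + Real.sqrt (2 * (7 + 6047)) + (Real.sqrt (2 * (7 + 6047)) + Real.sqrt (2 * (7 + 6047)))))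
    (ρ := (2 : ℝ) ^ 10) (ρ₀ := (2 : ℝ) ^ 15) (P := P) (by positivity) (by positivity) hP (lt_of_le_of_lt hx (by norm_num))
  refine h.trans ?_
  set x := Real.exp 2 * (Real.sqrt (2 * (7 + 6047)) + Real.sqrt (2 * (7 + 6047)) +
      (Real.sqrt (2 * (7 + 6047)) + Real.sqrt (2 * (7 + 6047)) + (Real.sqrt (2 * (7 + 6047)) + Real.sqrt (2 * (7 + 6047)))) +
      (2 : ℝ) ^ 10) * ((2 : ℝ) ^ 15)⁻¹ with hxdef
  have hx2 : x ^ 2 ≤ 1 / 4 := by nlinarith [mul_le_mul hx hx hx0 (by norm_num : (0 : ℝ) ≤ 1 / 2)]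
  rw [div_le_iff₀ (by nlinarith)]
  nlinarith [mul_le_mul_of_nonneg_left hx2 hP]

/-- **The smallness values of both weighted steps are `≤ 1/2`**: `e·(a+a+(a+a))·X/K ≤ 1/2` for `X ≤ (4/3)P`, `a·P ≤ 6·2^72/2^80`,
`K ≥ 4·2(7+6047)` (`K = (κ+κ′)²` resp. `(3(κ+κ′))²`). -/
theorem theta_step_le_half {a X P K : ℝ} (ha : 0 ≤ a) (hX0 : 0 ≤ X) (hX : X ≤ 4 / 3 * P)
    (haP : a * P ≤ 6 * (2 : ℝ) ^ 72 * (1 / (2 : ℝ) ^ 80)) (hK : 4 * (2 * (7 + 6047)) ≤ K) :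
    Real.exp 1 * (a + a + (a + a)) * X / K ≤ 1 / 2 := by
  have he : Real.exp 1 ≤ 3 := by have := Real.exp_one_lt_d9; linarith
  have hK0 : 0 < K := lt_of_lt_of_le (by norm_num) hK
  have h1 : a * X ≤ 4 / 3 * (a * P) := by nlinarith [mul_le_mul_of_nonneg_left hX ha]
  have h2 : a * X ≤ 1 / 32 := h1.trans (by linarith [haP.trans (by norm_num : 6 * (2 : ℝ) ^ 72 * (1 / (2 : ℝ) ^ 80) ≤ 3 / 128)])
  have h3 : Real.exp 1 * (a + a + (a + a)) * X = 4 * Real.exp 1 * (a * X) := by ring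
  rw [h3, div_le_iff₀ hK0]
  have h4 : 4 * Real.exp 1 * (a * X) ≤ 4 * 3 * (1 / 32) := by
    have h0 : 0 ≤ a * X := mul_nonneg ha hX0
    gcongr
  linarith

/-- **The weighted-step output `≤ r·8P`**: `r·(e·X)/(1 − θ′) ≤ r·(8P)` for `0 ≤ r`, `0 ≤ X ≤ (4/3)P`, `θ′ ≤ 1/2`. -/
theorem stepOut_le {r X P θ' : ℝ} (hr : 0 ≤ r) (hX0 : 0 ≤ X) (hX : X ≤ 4 / 3 * P) (hθ : θ' ≤ 1 / 2) :
    r * (Real.exp 1 * X) / (1 - θ') ≤ r * (8 * P) := by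
  have he : Real.exp 1 ≤ 3 := by have := Real.exp_one_lt_d9; linarith
  have he0 := (Real.exp_pos 1).le
  rw [div_le_iff₀ (by linarith)]
  have h1 : Real.exp 1 * X ≤ 3 * (4 / 3 * P) := by gcongr
  have h2 : r * (Real.exp 1 * X) ≤ r * (4 * P) := mul_le_mul_of_nonneg_left (by linarith) hr
  have hP : 0 ≤ P := by linarith
  nlinarith [mul_nonneg hr hP]

/-- **The first `Σ_{a,b′<3}` block of the β′ door** with `B₂ m = (2^10)⁻¹^m·(8P)`: `≤ 2560·T·P²` (crude: the `2^-40` is dropped). -/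
theorem sum_ite_B₂_le {T : ℝ} (P : ℝ) (hT : 0 ≤ T) :
    ∑ a ∈ range (1 + 2), ∑ b' ∈ range (1 + 2),
        (if a + b' = 1 + 1 then (((a + 1) * (b' + 1) : ℕ) : ℝ) *
          (2 * T * (((2 : ℝ) ^ 10)⁻¹ ^ (a + 1) * (8 * P)) * (((2 : ℝ) ^ 10)⁻¹ ^ (b' + 1) * (8 * P)) +
            2 * T * (((2 : ℝ) ^ 10)⁻¹ ^ (a + 1) * (8 * P)) * (((2 : ℝ) ^ 10)⁻¹ ^ (b' + 1) * (8 * P)))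
        else 0) ≤ 2560 * T * P ^ 2 := by
  simp only [sum_range_succ, sum_range_zero]
  norm_num
  nlinarith [mul_nonneg hT (sq_nonneg P)]

/-- **The second `Σ_{a,b′<3}` block of the β′ door** with `Bf m = 8P`: `≤ 2560·(α′+α)·P²/(R′+1)`... stated with `A2 = α′ + α`. -/
theorem sum_ite_Bf_le (A2 P : ℝ) {R1 : ℝ} (hR1 : 0 < R1) :
    ∑ a ∈ range (1 + 2), ∑ b' ∈ range (1 + 2),
        (if a + b' = 1 + 1 then (((a + 1) * (b' + 1) : ℕ) : ℝ) *
          (A2 * ((8 * P) / R1) * (8 * P) + A2 * (8 * P) * ((8 * P) / R1)) else 0) ≤ 1280 * A2 * P ^ 2 / R1 := by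
  simp only [sum_range_succ, sum_range_zero]
  norm_num
  have h : (3 : ℝ) * (A2 * (8 * P / R1) * (8 * P) + A2 * (8 * P) * (8 * P / R1)) +
      (4 * (A2 * (8 * P / R1) * (8 * P) + A2 * (8 * P) * (8 * P / R1)) +
        3 * (A2 * (8 * P / R1) * (8 * P) + A2 * (8 * P) * (8 * P / R1))) = 1280 * A2 * P ^ 2 / R1 := by
    field_simp
    ring
  linarith [h.le]

/-- **The final rate arithmetic** (after the two `Σ` blocks are majorised): with `p = 6·2^72·u`, `A·u ≤ 2^-80`, `u ≤ 2^-128`, `L ≤ 4·r1`,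
`L ≤ 2h`, the instantiated β′ bound is `≤ 1/L`. -/
theorem spLeg_arith {Nr β A u r1 h L : ℝ} (hNr : 0 < Nr) (hβ : 0 < β) (hA : 0 ≤ A) (hu : 0 ≤ u)
    (hAu : A * u ≤ 1 / (2 : ℝ) ^ 80) (hu' : u ≤ 1 / (2 : ℝ) ^ 128) (hr1 : 0 < r1) (hh : 0 < h) (hL : 0 < L)
    (hLr : L ≤ 4 * r1) (hLh : L ≤ 2 * h) :
    2 * Nr / β * (6 * ((2 : ℝ) ^ 74 / r1) * (((2 : ℝ) ^ 10)⁻¹ ^ (1 + 3) * (8 * (6 * (2 : ℝ) ^ 72 * u * β / Nr))) +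
          1 / 2 * (2560 * (Nr / β * A / r1) * (6 * (2 : ℝ) ^ 72 * u * β / Nr) ^ 2) +
        (6 * ((2 * (7 + 6047) + 2 * (7 + 6047)) / r1) * (8 * (6 * (2 : ℝ) ^ 72 * u * β / Nr)) +
          1 / 2 * (1280 * (Nr / β * A + Nr / β * A) * (6 * (2 : ℝ) ^ 72 * u * β / Nr) ^ 2 / r1))) +
      2 * (2 * Nr / β * (((2 : ℝ) ^ 15)⁻¹ ^ (2 * 1) * (6 * (2 : ℝ) ^ 72 * u * β / Nr)) / h) ≤ 1 / L := by
  set q : ℝ := 6 * (2 : ℝ) ^ 72 * u with hq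
  have hq0 : 0 ≤ q := by positivity
  have hqle : q ≤ 6 / (2 : ℝ) ^ 56 := by
    rw [hq]; have := mul_le_mul_of_nonneg_left hu' (show (0 : ℝ) ≤ 6 * (2 : ℝ) ^ 72 by positivity)
    refine this.trans ?_; norm_num
  have hAq2 : A * q ^ 2 ≤ 36 / (2 : ℝ) ^ 64 := by
    have h1 : A * q ^ 2 = 36 * (2 : ℝ) ^ 144 * (A * u) * u := by rw [hq]; ring
    rw [h1]
    have h2 : 36 * (2 : ℝ) ^ 144 * (A * u) * u ≤ 36 * (2 : ℝ) ^ 144 * (1 / (2 : ℝ) ^ 80) * (1 / (2 : ℝ) ^ 128) := by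
      have : 0 ≤ A * u := by positivity
      gcongr
    exact h2.trans (by norm_num)
  -- the bound in `q`-form
  have hE : 2 * Nr / β * (6 * ((2 : ℝ) ^ 74 / r1) * (((2 : ℝ) ^ 10)⁻¹ ^ (1 + 3) * (8 * (6 * (2 : ℝ) ^ 72 * u * β / Nr))) +
          1 / 2 * (2560 * (Nr / β * A / r1) * (6 * (2 : ℝ) ^ 72 * u * β / Nr) ^ 2) +
        (6 * ((2 * (7 + 6047) + 2 * (7 + 6047)) / r1) * (8 * (6 * (2 : ℝ) ^ 72 * u * β / Nr)) +
          1 / 2 * (1280 * (Nr / β * A + Nr / β * A) * (6 * (2 : ℝ) ^ 72 * u * β / Nr) ^ 2 / r1))) +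
      2 * (2 * Nr / β * (((2 : ℝ) ^ 15)⁻¹ ^ (2 * 1) * (6 * (2 : ℝ) ^ 72 * u * β / Nr)) / h) =
      (96 * (2 : ℝ) ^ 74 * ((2 : ℝ) ^ 10)⁻¹ ^ 4 * q + 2560 * A * q ^ 2 + 96 * (2 * (7 + 6047) + 2 * (7 + 6047)) * q +
          2560 * A * q ^ 2) / r1 + 4 * ((2 : ℝ) ^ 15)⁻¹ ^ 2 * q / h := by
    rw [hq]
    field_simp
    ring
  rw [hE]
  have hnum : 96 * (2 : ℝ) ^ 74 * ((2 : ℝ) ^ 10)⁻¹ ^ 4 * q + 2560 * A * q ^ 2 + 96 * (2 * (7 + 6047) + 2 * (7 + 6047)) * q +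
      2560 * A * q ^ 2 ≤ 1 / (2 : ℝ) ^ 12 := by
    norm_num at hqle hAq2 ⊢
    nlinarith [hqle, hAq2, hq0]
  have htail : 4 * ((2 : ℝ) ^ 15)⁻¹ ^ 2 * q ≤ 1 / (2 : ℝ) ^ 12 := by
    norm_num at hqle ⊢; nlinarith [hqle, hq0]
  have h1 : (96 * (2 : ℝ) ^ 74 * ((2 : ℝ) ^ 10)⁻¹ ^ 4 * q + 2560 * A * q ^ 2 + 96 * (2 * (7 + 6047) + 2 * (7 + 6047)) * q +
      2560 * A * q ^ 2) / r1 ≤ (1 / (2 : ℝ) ^ 12) * (4 / L) := by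
    rw [div_le_iff₀ hr1]
    have h4 : (1 : ℝ) / (2 : ℝ) ^ 12 * (4 / L) * r1 = 1 / (2 : ℝ) ^ 12 * (4 * r1) / L := by ring
    rw [h4, le_div_iff₀ hL]
    have := mul_le_mul hnum hLr hL.le (by positivity)
    linarith
  have h2 : 4 * ((2 : ℝ) ^ 15)⁻¹ ^ 2 * q / h ≤ (1 / (2 : ℝ) ^ 12) * (2 / L) := by
    rw [div_le_iff₀ hh]
    have h4 : (1 : ℝ) / (2 : ℝ) ^ 12 * (2 / L) * h = 1 / (2 : ℝ) ^ 12 * (2 * h) / L := by ring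
    rw [h4, le_div_iff₀ hL]
    have := mul_le_mul htail hLh hL.le (by positivity)
    linarith
  have h3 : (1 : ℝ) / (2 : ℝ) ^ 12 * (4 / L) + 1 / (2 : ℝ) ^ 12 * (2 / L) ≤ 1 / L := by
    have hL' : 0 < 1 / L := by positivity
    have h4 : (1 : ℝ) / (2 : ℝ) ^ 12 * (4 / L) + 1 / (2 : ℝ) ^ 12 * (2 / L) = 6 / (2 : ℝ) ^ 12 * (1 / L) := by ring
    rw [h4]
    nlinarith
  linarith

/-! ## §2 The scale-`0` spatial leg rate at the registered thresholds -/

section SpLeg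

variable {L₁ L₂ b M : ℕ} [NeZero L₁] [NeZero L₂] [NeZero M]

/-- **THE SCALE-`0` SPATIAL NESTED LEG AT THE REGISTERED THRESHOLDS**: `|klLocalPart L₁ M … (K₀ L₁) 0 θ − klLocalPart L₂ M … (K₀ L₂) 0 θ| ≤ 1/L₁`
for `L₂ = b·L₁`, `R.WF`, `μ ∈ klWindowC`, `0 < U ≤ klEngU₀9 P R c`, `klBetaMin ≤ β`, `klEngL₃ β U ≤ L₁`, `klEngM₃ β U Lᵢ ≤ M` — the β′ door
`abs_klLocalPart_flowFrame_zero_sub_le_of_gridData_maj` at `R = R′ = (L₁−1)/4`, `ρ₀ = 2^15`, `ρf = 1`, `ρ₂ = 2^10` with every datum discharged. -/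
theorem abs_klLocalPart_flowFrame_zero_spLeg_le_inv (P : SplitConsts) {R : RenConsts} (hR : R.WF) {c U μ β : ℝ}
    (hμ : μ ∈ klWindowC) (hU : 0 < U) (hUle : U ≤ klEngU₀9 P R c) (hβ : klBetaMin ≤ β) (hL : L₂ = b * L₁)
    (hL₁ : klEngL₃ β U ≤ L₁) (hM₁ : klEngM₃ β U L₁ ≤ M) (hM₂ : klEngM₃ β U L₂ ≤ M) (θ : ℝ) :
    |klLocalPart L₁ M β U μ (klFlowFrameU L₁ M β U μ 0) 0 θ - klLocalPart L₂ M β U μ (klFlowFrameU L₂ M β U μ 0) 0 θ| ≤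
      1 / (L₁ : ℝ) := by
  haveI : NeZero (2 * (2 * M)) := ⟨by have := NeZero.ne M; omega⟩
  -- thresholds and doors
  have hβ0 : 0 < β := lt_of_lt_of_le (by norm_num [klBetaMin]) hβ
  have hb0 : b ≠ 0 := by rintro rfl; exact NeZero.ne L₂ (by rw [hL, zero_mul])
  have hL₁₂ : L₁ ≤ L₂ := by rw [hL]; exact Nat.le_mul_of_pos_left _ (Nat.pos_of_ne_zero hb0)
  have hdvd : L₁ ∣ L₂ := ⟨b, by rw [hL, mul_comm]⟩
  have hL₂ : klEngL₃ β U ≤ L₂ := hL₁.trans hL₁₂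
  have hβL₁ : β ≤ L₁ := le_of_klEngL₃_le hL₁
  have hβL₂ : β ≤ L₂ := le_of_klEngL₃_le hL₂
  have hK : FrameOK R U 0 μ 0 := klFrameOK_zeroC hR U 0 hμ
  have hU1 : |U| ≤ 1 := abs_le_one_of_le_klEngU₀9 P hU hUle
  have hAU : klE3A1 R * |U| ≤ 1 / (2 : ℝ) ^ 80 := klE3A1_mul_abs_le_of_le_klEngU₀9 P hU hUle
  have hU128 : |U| ≤ 1 / (2 : ℝ) ^ 128 := abs_le_two_pow_neg_of_le_klEngU₀9 P hU hUle
  have hN : (0 : ℝ) < ((2 * (2 * M) : ℕ) : ℝ) := by exact_mod_cast Nat.pos_of_ne_zero (NeZero.ne _)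
  have hA := klE3A1_pos R
  have hL₁pos : (0 : ℝ) < L₁ := by exact_mod_cast Nat.pos_of_ne_zero (NeZero.ne L₁)
  have hκ := sqrt_gramSharp_pos
  have hκsq := sqrt_gramSharp_sq
  -- one-volume data at both volumes (Gram, grid partition function, profile at `ρ₀ = 2^15`)
  obtain ⟨hGB₁, hZ₁, hprof₁⟩ := scaleZero_gridData_registered (μ := μ) hK hR hU1 hβ hL₁ hM₁ hAU
  obtain ⟨hGB₂, hZ₂, hprof₂⟩ := scaleZero_gridData_registered (μ := μ) hK hR hU1 hβ hL₂ hM₂ hAU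
  -- the two constants `a = (N/β)·klE3A1 R` and `P = 6·2^72·|U|·|β|/N`
  have ha0 : 0 < ((2 * (2 * M) : ℕ) : ℝ) / β * klE3A1 R := by positivity
  have hPp0 : 0 ≤ 6 * (2 : ℝ) ^ 72 * |U| * |β| / ((2 * (2 * M) : ℕ) : ℝ) := by positivity
  have haP : ((2 * (2 * M) : ℕ) : ℝ) / β * klE3A1 R * (6 * (2 : ℝ) ^ 72 * |U| * |β| / ((2 * (2 * M) : ℕ) : ℝ)) =
      6 * (2 : ℝ) ^ 72 * (klE3A1 R * |U|) := by
    rw [abs_of_pos hβ0]; field_simp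
  have haP' : ((2 * (2 * M) : ℕ) : ℝ) / β * klE3A1 R * (6 * (2 : ℝ) ^ 72 * |U| * |β| / ((2 * (2 * M) : ℕ) : ℝ)) ≤
      6 * (2 : ℝ) ^ 72 * (1 / (2 : ℝ) ^ 80) := by rw [haP]; gcongr
  -- zone depth `R = R′ = (L₁ − 1)/4`
  have hRR : (L₁ - 1) / 4 + (L₁ - 1) / 4 ≤ (L₁ - 1) / 2 := by omega
  have hR1 : (0 : ℝ) < (((L₁ - 1) / 4 : ℕ) : ℝ) + 1 := by positivity
  -- the two step profiles and their smallness
  have hVf := normV_f_geometric_le (Γ := GridLeg (GridPoint L₂ (2 * (2 * M)))) hPp0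
  have hV2 := normV_two_geometric_le (Γ := GridLeg (GridPoint L₂ (2 * (2 * M)))) hPp0
  have hNw0 : ∀ m' : ℕ, 0 ≤ ((2 : ℝ) ^ 15)⁻¹ ^ (2 * m') * (6 * (2 : ℝ) ^ 72 * |U| * |β| / ((2 * (2 * M) : ℕ) : ℝ)) :=
    fun m' => by positivity
  have hVf0 : 0 ≤ normV (GridLeg (GridPoint L₂ (2 * (2 * M)))) (Real.sqrt (2 * (7 + 6047)) + Real.sqrt (2 * (7 + 6047))) 1
      (fun m' : ℕ => ((2 : ℝ) ^ 15)⁻¹ ^ (2 * m') * (6 * (2 : ℝ) ^ 72 * |U| * |β| / ((2 * (2 * M) : ℕ) : ℝ))) :=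
    normV_nonneg (by positivity) (by positivity) hNw0
  have hV20 : 0 ≤ normV (GridLeg (GridPoint L₂ (2 * (2 * M))))
      (Real.sqrt (2 * (7 + 6047)) + Real.sqrt (2 * (7 + 6047)) +
        (Real.sqrt (2 * (7 + 6047)) + Real.sqrt (2 * (7 + 6047)) + (Real.sqrt (2 * (7 + 6047)) + Real.sqrt (2 * (7 + 6047)))))
      ((2 : ℝ) ^ 10) (fun m' : ℕ => ((2 : ℝ) ^ 15)⁻¹ ^ (2 * m') * (6 * (2 : ℝ) ^ 72 * |U| * |β| / ((2 * (2 * M) : ℕ) : ℝ))) :=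
    normV_nonneg (by positivity) (by positivity) hNw0
  have hKf : 4 * (2 * (7 + 6047)) ≤ (Real.sqrt (2 * (7 + 6047)) + Real.sqrt (2 * (7 + 6047))) ^ 2 := by nlinarith
  have hK2 : 4 * (2 * (7 + 6047)) ≤ (Real.sqrt (2 * (7 + 6047)) + Real.sqrt (2 * (7 + 6047)) +
      (Real.sqrt (2 * (7 + 6047)) + Real.sqrt (2 * (7 + 6047)) + (Real.sqrt (2 * (7 + 6047)) + Real.sqrt (2 * (7 + 6047))))) ^ 2 := by
    nlinarith
  have hθw := theta_step_le_half ha0.le hVf0 hVf haP' hKf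
  have hθ₂ := theta_step_le_half ha0.le hV20 hV2 haP' hK2
  -- the β′ door, instantiated
  have hmaj := abs_klLocalPart_flowFrame_zero_sub_le_of_gridData_maj (L₁ := L₁) (L₂ := L₂) (b := b) (M := M) hL hβ0 U μ
    ((L₁ - 1) / 4) ((L₁ - 1) / 4) hRR
    (T := ((2 * (2 * M) : ℕ) : ℝ) / β * klE3A1 R / ((((L₁ - 1) / 4 : ℕ) : ℝ) + 1)) (by positivity)
    (fun X' => farRow_scaleZero_le_klE3A1 hK hR hU1 hβ hL₂ hM₂ ((L₁ - 1) / 4) X')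
    (Te := (2 : ℝ) ^ 74 / ((((L₁ - 1) / 4 : ℕ) : ℝ) + 1)) (fun X' t σ c' => hsec_scaleZero (L := L₂) (M := M) hβ0 μ ((L₁ - 1) / 4) X' t σ c')
    (s := 2 * (7 + 6047)) (s' := 2 * (7 + 6047)) (by norm_num) (by norm_num)
    (hs_scaleZero (L := L₁) (M := M) hK hβ hβL₁) (hs_scaleZero (L := L₂) (M := M) hK hβ hβL₂)
    (α := ((2 * (2 * M) : ℕ) : ℝ) / β * klE3A1 R) (α' := ((2 * (2 * M) : ℕ) : ℝ) / β * klE3A1 R) (by positivity)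
    (row_scaleZero_le_klE3A1 hK hR hU1 hβ hL₁ hM₁) (row_scaleZero_le_klE3A1 hK hR hU1 hβ hL₂ hM₂)
    (m₁ := ((2 * (2 * M) : ℕ) : ℝ) / β * klE3A1 R) (m₁' := ((2 * (2 * M) : ℕ) : ℝ) / β * klE3A1 R) ha0.le ha0.le
    (rowTnorm_scaleZero_le_klE3A1 hK hR hU1 hβ hL₁ hM₁)
    (rowTnormReduce_scaleZero_le_klE3A1 (Lc := L₁) (L := L₂) hdvd hK hR hU1 hβ hL₂ hM₂)
    hκ hκ.le hGB₁ hGB₂ hZ₁ hZ₂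
    (fun m' : ℕ => ((2 : ℝ) ^ 15)⁻¹ ^ (2 * m') * (6 * (2 : ℝ) ^ 72 * |U| * |β| / ((2 * (2 * M) : ℕ) : ℝ))) hNw0 hprof₁
    (ρf := 1) one_pos (lt_of_le_of_lt hθw (by norm_num)) (ρ₂ := (2 : ℝ) ^ 10) (by positivity) (lt_of_le_of_lt hθ₂ (by norm_num))
    (fun _ => 8 * (6 * (2 : ℝ) ^ 72 * |U| * |β| / ((2 * (2 * M) : ℕ) : ℝ)))
    (fun m => ((2 : ℝ) ^ 10)⁻¹ ^ m * (8 * (6 * (2 : ℝ) ^ 72 * |U| * |β| / ((2 * (2 * M) : ℕ) : ℝ))))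
    (fun m => by simpa only [inv_one, one_pow, one_mul] using stepOut_le (r := (1 : ℝ)⁻¹ ^ m) (by positivity) hVf0 hVf hθw)
    (fun m => stepOut_le (r := ((2 : ℝ) ^ 10)⁻¹ ^ m) (by positivity) hV20 hV2 hθ₂)
    (Nw₁ := ((2 : ℝ) ^ 15)⁻¹ ^ (2 * 1) * (6 * (2 : ℝ) ^ 72 * |U| * |β| / ((2 * (2 * M) : ℕ) : ℝ)))
    (hprof₂ 1 0 ((((0 : Fin (2 * (2 * M))), fun _ => (((L₁ - 1) / 2 : ℕ) : ZMod L₂)), 0), 0)) θ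
  refine hmaj.trans ?_
  simp only [abs_of_pos hβ0]
  have hS₁ := sum_ite_B₂_le (T := ((2 * (2 * M) : ℕ) : ℝ) / β * klE3A1 R / ((((L₁ - 1) / 4 : ℕ) : ℝ) + 1))
    (6 * (2 : ℝ) ^ 72 * |U| * β / ((2 * (2 * M) : ℕ) : ℝ)) (by positivity)
  have hS₂ := sum_ite_Bf_le (((2 * (2 * M) : ℕ) : ℝ) / β * klE3A1 R + ((2 * (2 * M) : ℕ) : ℝ) / β * klE3A1 R)
    (6 * (2 : ℝ) ^ 72 * |U| * β / ((2 * (2 * M) : ℕ) : ℝ)) hR1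
  have hhalf : ‖(2 : ℂ)⁻¹‖ = 1 / 2 := by simp [norm_inv]
  have h6 : (((1 + 1 + 1) * (1 + 1 + 2) : ℕ) : ℝ) / 2 = 6 := by norm_num
  rw [hhalf, h6]
  have hL4 : (L₁ : ℝ) ≤ 4 * ((((L₁ - 1) / 4 : ℕ) : ℝ) + 1) := by
    have : L₁ ≤ 4 * ((L₁ - 1) / 4 + 1) := by omega
    exact_mod_cast this
  have hL2 : (L₁ : ℝ) ≤ 2 * ((((L₁ - 1) / 2 + 1 : ℕ) : ℝ)) := by
    have : L₁ ≤ 2 * ((L₁ - 1) / 2 + 1) := by omega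
    exact_mod_cast this
  have hh0 : (0 : ℝ) < (((L₁ - 1) / 2 + 1 : ℕ) : ℝ) := by positivity
  have hpre : 0 ≤ 2 * ((2 * (2 * M) : ℕ) : ℝ) / β := by positivity
  calc _ ≤ 2 * ((2 * (2 * M) : ℕ) : ℝ) / β *
        (6 * ((2 : ℝ) ^ 74 / ((((L₁ - 1) / 4 : ℕ) : ℝ) + 1)) * (((2 : ℝ) ^ 10)⁻¹ ^ (1 + 3) * (8 * (6 * (2 : ℝ) ^ 72 * |U| * β / ((2 * (2 * M) : ℕ) : ℝ)))) +
            1 / 2 * (2560 * (((2 * (2 * M) : ℕ) : ℝ) / β * klE3A1 R / ((((L₁ - 1) / 4 : ℕ) : ℝ) + 1)) *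
              (6 * (2 : ℝ) ^ 72 * |U| * β / ((2 * (2 * M) : ℕ) : ℝ)) ^ 2) +
          (6 * ((2 * (7 + 6047) + 2 * (7 + 6047)) / ((((L₁ - 1) / 4 : ℕ) : ℝ) + 1)) * (8 * (6 * (2 : ℝ) ^ 72 * |U| * β / ((2 * (2 * M) : ℕ) : ℝ))) +
            1 / 2 * (1280 * (((2 * (2 * M) : ℕ) : ℝ) / β * klE3A1 R + ((2 * (2 * M) : ℕ) : ℝ) / β * klE3A1 R) *
              (6 * (2 : ℝ) ^ 72 * |U| * β / ((2 * (2 * M) : ℕ) : ℝ)) ^ 2 / ((((L₁ - 1) / 4 : ℕ) : ℝ) + 1)))) +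
        2 * (2 * ((2 * (2 * M) : ℕ) : ℝ) / β * (((2 : ℝ) ^ 15)⁻¹ ^ (2 * 1) * (6 * (2 : ℝ) ^ 72 * |U| * β / ((2 * (2 * M) : ℕ) : ℝ))) /
          ((((L₁ - 1) / 2 + 1 : ℕ) : ℝ))) := by
        gcongr
    _ ≤ 1 / (L₁ : ℝ) := spLeg_arith hN hβ0 hA.le (abs_nonneg U) hAU hU128 hR1 hh0 hL₁pos hL4 hL2

end SpLeg

end Summit.HubbardSuperconductivity.HubbardSuperconductivity.Theorems.TwoVolumeDefect

/-! ## §3 Literally the `hsp` binder of `EngineV8.stub_twoLeg_scale0_of_spLeg_Q7U9` -/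

namespace Summit.HubbardSuperconductivity.HubbardSuperconductivity.Theorems.EngineV8

set_option linter.dupNamespace false -- summit = problem name (single-conjunct summit), D-0017

open Real Finset Literature.MathematicalPhysics.QuantumLattice Literature.Probability.LatticeModels
open Literature.MathematicalPhysics.QuantumLattice.FermiRG
open Summit.HubbardSuperconductivity.HubbardSuperconductivity.Theorems.KLProgrammeLegKernels
open Summit.HubbardSuperconductivity.HubbardSuperconductivity.Theorems.KLRegimeSplit
open Summit.HubbardSuperconductivity.HubbardSuperconductivity.Theorems.TwoVolumeDefect

/-- **`hsp` OF `stub_twoLeg_scale0_of_spLeg_Q7U9`** (the REGISTERED keying: package `klEngQ7 P R`, door `klEngU₀9 P R c`), from the stub's own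
binders `R.WF`, `μ ∈ klWindowC`, `0 < U ≤ klEngU₀9 P R c`, `klBetaMin ≤ β`, `klEngL₃ β U ≤ L`: for every reader threshold `Mq` (unused), all
`L ≤ L₁ ∣ L₂`, every cutoff `M₂` above both Matsubara thresholds `(klEngQ7 P R).M0 β Lᵢ` (= `klEngM₃ β U Lᵢ`), ANY comparison histories (empty at
scale `0`) and every angle: the scale-`0` readings at the two volumes differ by `≤ 1/L₁ ≤ (klEngQ7 P R).CL β 0/4/L₁`. -/
theorem twoLeg_scale0_hsp_klEngQ7U9 (P : SplitConsts) {R : RenConsts} (hR : R.WF) (c : ℝ) {μ : ℝ} (hμ : μ ∈ klWindowC) {U : ℝ}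
    (hU : 0 < U) (hUle : U ≤ klEngU₀9 P R c) {β : ℝ} (hβ : klBetaMin ≤ β) {L : ℕ} (hL : klEngL₃ β U ≤ L)
    (Mq : ℕ → ℕ) (L₁ L₂ M₂ : ℕ) [NeZero L₁] [NeZero L₂] [NeZero M₂] (hLL₁ : L ≤ L₁) (hdvd : L₁ ∣ L₂)
    (hM₁ : (klEngQ7 P R).M0 β L₁ ≤ M₂) (_hMq₁ : Mq L₁ ≤ M₂) (hM₂ : (klEngQ7 P R).M0 β L₂ ≤ M₂) (_hMq₂ : Mq L₂ ≤ M₂)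
    (_h₁ : ∀ j < 0, histV17F2 L₁ M₂ klEngGeo7 P (klEngQ7 P R) R β U μ j ∧ TwoLegSlopes L₁ M₂ R β U μ (klFlowFrameU L₁ M₂ β U μ j) j)
    (_h₂ : ∀ j < 0, histV17F2 L₂ M₂ klEngGeo7 P (klEngQ7 P R) R β U μ j ∧ TwoLegSlopes L₂ M₂ R β U μ (klFlowFrameU L₂ M₂ β U μ j) j)
    (θ : ℝ) :
    |klLocalPart L₁ M₂ β U μ (klFlowFrameU L₁ M₂ β U μ 0) 0 θ - klLocalPart L₂ M₂ β U μ (klFlowFrameU L₂ M₂ β U μ 0) 0 θ| ≤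
      (klEngQ7 P R).CL β 0 / 4 / L₁ := by
  obtain ⟨b, hb⟩ := hdvd
  have hLb : L₂ = b * L₁ := by rw [hb, mul_comm]
  have hM0₁ : klEngM₃ β U L₁ ≤ M₂ := by
    have h : (klEngQ7 P R).M0 β L₁ = 2 ^ 10 * (⌈|β|⌉₊ + 1) ^ 2 * (L₁ + 1) ^ 2 := rfl
    rw [h] at hM₁; exact hM₁
  have hM0₂ : klEngM₃ β U L₂ ≤ M₂ := by
    have h : (klEngQ7 P R).M0 β L₂ = 2 ^ 10 * (⌈|β|⌉₊ + 1) ^ 2 * (L₂ + 1) ^ 2 := rfl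
    rw [h] at hM₂; exact hM₂
  have hL₁pos : (0 : ℝ) < L₁ := by exact_mod_cast Nat.pos_of_ne_zero (NeZero.ne L₁)
  have h := abs_klLocalPart_flowFrame_zero_spLeg_le_inv P hR hμ hU hUle hβ hLb (hL.trans hLL₁) hM0₁ hM0₂ θ
  refine h.trans (div_le_div_of_nonneg_right ?_ hL₁pos.le)
  rw [klEngQ7_CL]
  have h4 := four_le_klEngQ6_CL_zero P R β
  linarith

end Summit.HubbardSuperconductivity.HubbardSuperconductivity.Theorems.EngineV8

end
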